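import Mathlib
import Literature.Analysis.FluidPDE.TaoCascadeNoLow
import Literature.Analysis.FluidPDE.Tao2016AveragedNS.RenormalisedCascadeWaves
import HarnessLib

/-!
# Tao 2016, §4: dictionary between the scalar-family and the shell-vector form of the cascade nonlinearity

T. Tao, *Finite time blowup for an averaged three-dimensional Navier–Stokes equation*, J. Amer.
Math. Soc. **29** (2016) 601–674 = arXiv:1402.0290v3, §4: the cascade operator (4.1) on the shift
set `S = {(0,0,0),(1,0,0),(0,1,0),(0,0,1)}`, the main term of the equation of motion (4.8) of
Lemma 4.1 (the tree's `TaoCascade.quadTerm`), and the cubic sums of the proof of (4.13)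
(p. 23; the tree's `TaoCascade.topSum` / `botSum`, module `TaoCascadeNoLow`).

The tree carries TWO spellings of the same nonlinearity: the scalar-family form
`quadTerm ε₀ α X i n t` on families `X : Fin m → ℤ → ℝ → ℝ` (used by `CascadeODESolution[On/From]`,
`PseudoFlowOn`, `ViscousGlobal`, the no-low-frequency sums `topSum`/`botSum`, …) and the
shell-vector form by monomial type `tableQ` / `tableA` / `tableB` on `Em m` (used by `IsEternal`,
`IsEternalVisc`, `IsDSSWave`, `STable`, the flux constant `fluxConst`, …). This module is the
dictionary between them — pure finite algebra, nothing asserted about any table, MODEL lattice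
objects only (nothing about the Navier–Stokes equations):

* `tableQ_apply`, `tableA_apply`, `tableB_apply` — components of the three table maps as `qform`s;
* `quadTerm_eq_tables` — `quadTerm_{i,n} = Λ_n (Q x_n)_i + Λ_n (B(x_{n+1}, x_n))_i + Λ_{n-1} (A x_{n-1})_i`
  with `Λ_k = (1+ε₀)^{5k/2}`, `x_k = shellVec X k t`, and its vector form `shellVec_quadTerm`;
* `botSum_eq_inner`, `topSum_eq_inner` — the cubic sums of `TaoCascadeNoLow` as inner products:
  `B(n) = Λ_n ⟪x_{n+1}, A x_n⟫` (the energy flux through the bond `n → n+1`) and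
  `A(n) = Λ_n (⟪x_n, Q x_n⟫ + ⟪x_n, B(x_{n+1}, x_n)⟫)`.

With these, the X-side telescoping `sum_quadTerm_mul` / `sum_range_sum_quadTerm_mul`
(`TaoCascadeNoLow`) and the vector-side structure `table_sTable` / `hasDerivAt_physEnergy`
(`SelfSimilarCascadeResidues`, `BoundedEternalSolutions`) speak about the same quantities; in
particular an exact solution of (4.8) in the `X`-variables is, shell-vector-wise, a solution of the
lattice law written with `(Q, A, B)` — the algebraic half of the bridge between cascade
trajectories and eternal / DSS solutions of the renormalised lattice.
-/

noncomputable section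

open scoped RealInnerProductSpace

namespace Literature.Analysis.FluidPDE

namespace TaoCascade

variable {m : ℕ}

/-! ### Components of the table maps -/

/-- Component `i` of `Σ_j c_j • e_j` in `Em m` is `c_i`. [folklore] -/
private theorem sum_smul_single_apply (c : Fin m → ℝ) (i : Fin m) :
    (∑ j, c j • EuclideanSpace.single j (1 : ℝ)) i = c i := by
  have h : (∑ j, c j • EuclideanSpace.single j (1 : ℝ)) i =
      ⟪EuclideanSpace.single i (1 : ℝ), ∑ j, c j • EuclideanSpace.single j (1 : ℝ)⟫ := by
    rw [EuclideanSpace.inner_single_left]; simp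
  rw [h, inner_sum]
  simp [EuclideanSpace.inner_single_left]

/-- `Σ_i v_i · X_{i,n}(t) = ⟪x_n, v⟫` with `x_n = shellVec X n t`. [folklore] -/
private theorem sum_mul_shellVec (v : Em m) (X : Fin m → ℤ → ℝ → ℝ) (n : ℤ) (t : ℝ) :
    ∑ i, v i * X i n t = ⟪shellVec X n t, v⟫ := by
  rw [PiLp.inner_apply]
  refine Finset.sum_congr rfl fun i _ => ?_
  simp [shellVec_apply, mul_comm]

/-- Component form of the intra-shell map: `(Q x)_i = Σ_{i₁ i₂} α_{i₁ i₂ i,(0,0,0)} x_{i₁} x_{i₂}`.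
[cite: Tao2016AveragedNS, §4 (4.1), Lemma 4.1 (4.8)] -/
theorem tableQ_apply (α : Fin m → Fin m → Fin m → ℤ × ℤ × ℤ → ℝ) (x : Em m) (i : Fin m) :
    tableQ α x i = qform α (0, 0, 0) x x i := by
  unfold tableQ
  exact sum_smul_single_apply _ i

/-- Component form of the outflow map: `(A x)_i = Σ_{i₁ i₂} α_{i₁ i₂ i,(0,0,1)} x_{i₁} x_{i₂}`.
[cite: Tao2016AveragedNS, §4 (4.1), Lemma 4.1 (4.8)] -/
theorem tableA_apply (α : Fin m → Fin m → Fin m → ℤ × ℤ × ℤ → ℝ) (x : Em m) (i : Fin m) :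
    tableA α x i = qform α (0, 0, 1) x x i := by
  unfold tableA
  exact sum_smul_single_apply _ i

/-- Component form of the back-reaction map:
`(B(y, x))_i = Σ α_{i₁ i₂ i,(1,0,0)} y_{i₁} x_{i₂} + Σ α_{i₁ i₂ i,(0,1,0)} x_{i₁} y_{i₂}`.
[cite: Tao2016AveragedNS, §4 (4.1), Lemma 4.1 (4.8)] -/
theorem tableB_apply (α : Fin m → Fin m → Fin m → ℤ × ℤ × ℤ → ℝ) (y x : Em m) (i : Fin m) :
    tableB α y x i = qform α (1, 0, 0) y x i + qform α (0, 1, 0) x y i := by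
  unfold tableB
  exact sum_smul_single_apply _ i

/-! ### The dictionary `quadTerm` ↔ `(Q, B, A)` -/

/-- **Dictionary.** The cascade nonlinearity driving mode `(i, n)` splits along the shift set as
`quadTerm_{i,n} = Λ_n (Q x_n)_i + Λ_n (B(x_{n+1}, x_n))_i + Λ_{n-1} (A x_{n-1})_i`,
`Λ_k = (1+ε₀)^{5k/2}`, `x_k = shellVec X k t` (the `μ = (0,0,0)` monomials, the
`μ = (1,0,0), (0,1,0)` monomials, and the `μ = (0,0,1)` monomials of the shell below with ITS gain).
[cite: Tao2016AveragedNS, §4 (4.1) and Lemma 4.1 (4.8)] -/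
theorem quadTerm_eq_tables (ε₀ : ℝ) (α : Fin m → Fin m → Fin m → ℤ × ℤ × ℤ → ℝ)
    (X : Fin m → ℤ → ℝ → ℝ) (i : Fin m) (n : ℤ) (t : ℝ) :
    quadTerm ε₀ α X i n t =
      (1 + ε₀) ^ ((5 : ℝ) * n / 2) * tableQ α (shellVec X n t) i +
      (1 + ε₀) ^ ((5 : ℝ) * n / 2) * tableB α (shellVec X (n + 1) t) (shellVec X n t) i +
      (1 + ε₀) ^ ((5 : ℝ) * ((n : ℝ) - 1) / 2) * tableA α (shellVec X (n - 1) t) i := by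
  rw [tableQ_apply, tableA_apply, tableB_apply]
  unfold quadTerm qform
  have hS : shiftSet = {((0 : ℤ), (0 : ℤ), (0 : ℤ)), (1, 0, 0), (0, 1, 0), (0, 0, 1)} := rfl
  have h1 : ((0 : ℤ), (0 : ℤ), (0 : ℤ)) ∉
      ({((1 : ℤ), (0 : ℤ), (0 : ℤ)), (0, 1, 0), (0, 0, 1)} : Finset (ℤ × ℤ × ℤ)) := by decide
  have h2 : ((1 : ℤ), (0 : ℤ), (0 : ℤ)) ∉
      ({((0 : ℤ), (1 : ℤ), (0 : ℤ)), (0, 0, 1)} : Finset (ℤ × ℤ × ℤ)) := by decide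
  have h3 : ((0 : ℤ), (1 : ℤ), (0 : ℤ)) ∉ ({((0 : ℤ), (0 : ℤ), (1 : ℤ))} : Finset (ℤ × ℤ × ℤ)) := by
    decide
  simp only [hS, Finset.sum_insert h1, Finset.sum_insert h2, Finset.sum_insert h3,
    Finset.sum_singleton, Finset.sum_add_distrib, shellVec_apply,
    Int.cast_zero, Int.cast_one, sub_zero, add_zero, mul_add, add_assoc]
  refine congrArg₂ (· + ·) ?_ (congrArg₂ (· + ·) ?_ (congrArg₂ (· + ·) ?_ ?_)) <;>
  · rw [Finset.mul_sum]
    refine Finset.sum_congr rfl fun a _ => ?_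
    rw [Finset.mul_sum]
    refine Finset.sum_congr rfl fun b _ => ?_
    ring_nf

/-- **Dictionary, vector form.** The shell vector of the nonlinearity is
`(quadTerm_{·,n}) = Λ_n Q(x_n) + Λ_n B(x_{n+1}, x_n) + Λ_{n-1} A(x_{n-1})` in `Em m` — the right
side of Tao's lattice law written by monomial type (compare the law of `IsEternal`, which is this
identity in the self-similar variables with the gains renormalised to `(1, Λ⁻¹, Λ)`).
[cite: Tao2016AveragedNS, §4 (4.1) and Lemma 4.1 (4.8)] -/
theorem shellVec_quadTerm (ε₀ : ℝ) (α : Fin m → Fin m → Fin m → ℤ × ℤ × ℤ → ℝ)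
    (X : Fin m → ℤ → ℝ → ℝ) (n : ℤ) (t : ℝ) :
    shellVec (fun i k s => quadTerm ε₀ α X i k s) n t =
      (1 + ε₀) ^ ((5 : ℝ) * n / 2) • tableQ α (shellVec X n t) +
      (1 + ε₀) ^ ((5 : ℝ) * n / 2) • tableB α (shellVec X (n + 1) t) (shellVec X n t) +
      (1 + ε₀) ^ ((5 : ℝ) * ((n : ℝ) - 1) / 2) • tableA α (shellVec X (n - 1) t) := by
  ext i
  simp only [shellVec_apply, PiLp.add_apply, PiLp.smul_apply, smul_eq_mul]
  exact quadTerm_eq_tables ε₀ α X i n t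

/-! ### The cubic sums of the no-low-frequency argument as inner products -/

/-- Cyclic reindexing of a triple sum. [folklore] -/
private theorem sum3_cycle (f : Fin m → Fin m → Fin m → ℝ) :
    ∑ a, ∑ b, ∑ c, f a b c = ∑ c, ∑ a, ∑ b, f a b c := by
  have h1 : ∑ a, ∑ b, ∑ c, f a b c = ∑ a, ∑ c, ∑ b, f a b c :=
    Finset.sum_congr rfl fun a _ => Finset.sum_comm
  rw [h1, Finset.sum_comm]

/-- **The energy flux through the bond `n → n+1` as an inner product**: the cubic sum `B(n)` of the
proof of (4.13) is `B(n) = Λ_n ⟪x_{n+1}, A(x_n)⟫` (Tao's «energy flows from mode `n` to mode `n+1`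
at rate `λⁿ X_{n+1} X_n²», for a general table). [cite: Tao2016AveragedNS, §4 proof of (4.13) and §1.2] -/
theorem botSum_eq_inner (ε₀ : ℝ) (α : Fin m → Fin m → Fin m → ℤ × ℤ × ℤ → ℝ)
    (X : Fin m → ℤ → ℝ → ℝ) (n : ℤ) (t : ℝ) :
    botSum ε₀ α X n t =
      (1 + ε₀) ^ ((5 : ℝ) * n / 2) * ⟪shellVec X (n + 1) t, tableA α (shellVec X n t)⟫ := by
  rw [← sum_mul_shellVec]
  simp only [tableA_apply, qform, shellVec_apply]
  unfold botSum
  rw [sum3_cycle, Finset.mul_sum]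
  refine Finset.sum_congr rfl fun i₃ _ => ?_
  rw [Finset.sum_mul, Finset.mul_sum]
  refine Finset.sum_congr rfl fun i₁ _ => ?_
  rw [Finset.sum_mul, Finset.mul_sum]
  refine Finset.sum_congr rfl fun i₂ _ => ?_
  ring

/-- **The scale-`n` output part as inner products**: the cubic sum `A(n)` of the proof of (4.13)
is `A(n) = Λ_n (⟪x_n, Q x_n⟫ + ⟪x_n, B(x_{n+1}, x_n)⟫)`. [cite: Tao2016AveragedNS, §4 proof of (4.13)] -/
theorem topSum_eq_inner (ε₀ : ℝ) (α : Fin m → Fin m → Fin m → ℤ × ℤ × ℤ → ℝ)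
    (X : Fin m → ℤ → ℝ → ℝ) (n : ℤ) (t : ℝ) :
    topSum ε₀ α X n t =
      (1 + ε₀) ^ ((5 : ℝ) * n / 2) *
        (⟪shellVec X n t, tableQ α (shellVec X n t)⟫ +
          ⟪shellVec X n t, tableB α (shellVec X (n + 1) t) (shellVec X n t)⟫) := by
  rw [← sum_mul_shellVec, ← sum_mul_shellVec, ← Finset.sum_add_distrib]
  simp only [tableQ_apply, tableB_apply, qform, shellVec_apply]
  unfold topSum
  rw [sum3_cycle, Finset.mul_sum]
  refine Finset.sum_congr rfl fun i₃ _ => ?_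
  simp only [Finset.sum_add_distrib, add_mul, Finset.sum_mul, mul_add, Finset.mul_sum, add_assoc]
  refine congrArg₂ (· + ·) ?_ (congrArg₂ (· + ·) ?_ ?_) <;>
  · refine Finset.sum_congr rfl fun i₁ _ => Finset.sum_congr rfl fun i₂ _ => ?_
    ring

end TaoCascade

end Literature.Analysis.FluidPDE

end
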